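import Mathlib.RingTheory.SimpleModule.Isotypic
import Mathlib.Algebra.DirectSum.Decomposition
import Mathlib.RepresentationTheory.Maschke
import HarnessLib

/-!
# Crux `H413` — K2-LIT E3 «EllipticInputs», U12-h engine L2″: ISOTYPIC IDEMPOTENTS — the complete orthogonal family of equivariant projectors onto the
# isotypic components of a semisimple Noetherian module, and of a finite-dimensional representation of a finite group (Harish-Chandra's `K`-type projectors `P_d`)

Cell `hodgecm-mathlib`, Track B «K2-LIT», crux item `stmt-HodgeConjecture-24833` (h413), line `K2_E3_EllipticInputs`, socket U12-h `sig_K2E3CharLocConstNearRegular` (‹#9L›);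
companion of ★ L2 `K2E3LevelOperatorExpansion` (p855106: the character through ANY complete family of idempotents of a level space `V^{K′}`), which it feeds with
the family Harish-Chandra actually uses — the isotypic projectors of `V^{K′}` under the finite group `K ∕ K′` [HarishChandra1999, Lemma 14.8 «Plancherel formula for K»,
§15].  Seat K2E3-p09 (g0); `--supports stmt-HodgeConjecture-24833 --as helper`.  THEOREMS ONLY (existence statements; the projectors are Mathlib's
`DirectSum.decompose` components, no new `def`), no named fact, no instance, no notation, no `sorry`.  GENERIC (pure algebra).  HONEST LABEL: HC_CM is proved only
modulo the 7 printed citations (2 remaining named inputs: hLiu418 = stmt-HodgeConjecture-24832, h413 = stmt-HodgeConjecture-24833) until rung 0 closes; count-neutral engine.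

* §1 `exists_idempotents_of_isInternal` — an internal direct sum `M = ⨁ᵢ Aᵢ` of `R`-submodules over a finite index type has `R`-LINEAR projectors `pᵢ` with `Σ pᵢ = 1`,
  `pᵢ² = pᵢ`, `pᵢ pⱼ = 0` (`i ≠ j`), `pᵢ(M) ⊆ Aᵢ`, `pᵢ = id` on `Aᵢ` (Mathlib `DirectSum.IsInternal.chooseDecomposition`, `decompose_of_mem_same/ne`).
* §2 `exists_idempotents_isotypicComponents` — for a semisimple Noetherian `R`-module: the finitely many isotypic components (Mathlib `isotypicComponents`,
  `sSupIndep_isotypicComponents`, `sSup_isotypicComponents`) carry such a family of `R`-linear projectors, indexed by the components themselves.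
* §3 **`exists_isotypic_idempotents_representation`** — for a representation `τ` of a FINITE group `Q` on a finite-dimensional space `W` over a field of
  characteristic zero (Maschke ⇒ `W` semisimple over `k[Q]`): a complete orthogonal family of `k`-linear projectors `p_c ∈ End_k W`, indexed by the isotypic components
  `c` of `W` as a `k[Q]`-module (the `Q`-TYPES occurring in `W`), COMMUTING WITH EVERY `τ q`, with `p_c(W) = c` and `p_c = id` on `c`.  These are the `P_d` of
  Harish-Chandra's `Θ_d(g) = tr(P_d e_K π(g) e_K P_d)` (★ L2 `smoothTrace_eq_sum_integral_trace_idempotent`, ★ L2′∕L3∕L4 take «`p` commutes with `L_k`» as hypothesis —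
  discharged here).

## References
* [HarishChandra1999] Harish-Chandra (DeBacker–Sally), *Admissible Invariant Distributions on Reductive p-adic Groups*, ULECT 16 (1999): §14, Lemma 14.8, §15.
* [Serre1977] J.-P. Serre, *Linear Representations of Finite Groups*, GTM 42 (1977), §2.6 Thm. 8 (canonical decomposition and its projectors).
-/

set_option autoImplicit false
-- the mandated namespace repeats `HodgeConjecture.HodgeConjecture`, as in every `Theorems/*.lean` of this sub-problem
set_option linter.dupNamespace false

noncomputable section

open scoped DirectSum

namespace Summit.HodgeConjecture.HodgeConjecture.Cruxes.H413.K2E3IsotypicIdempotents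

/-! ## §1 Projectors of an internal direct sum -/

/-- **Projectors of an internal direct sum.**  `M = ⨁_{i ∈ ι} Aᵢ` internally (`ι` finite) ⇒ there are `R`-linear `pᵢ : M → M` with `Σᵢ pᵢ = 1`, `pᵢ² = pᵢ`, `pᵢ pⱼ = 0` for `i ≠ j`,
`pᵢ x ∈ Aᵢ` and `pᵢ x = x` for `x ∈ Aᵢ` (the components of Mathlib's `DirectSum.decompose`). [cite: Serre1977, §2.6 Thm. 8] -/
theorem exists_idempotents_of_isInternal {R M ι : Type*} [Ring R] [AddCommGroup M] [Module R M] [DecidableEq ι] [Fintype ι]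
    (A : ι → Submodule R M) (h : DirectSum.IsInternal A) :
    ∃ p : ι → Module.End R M, (∑ i, p i = 1) ∧ (∀ i, p i * p i = p i) ∧ (∀ i j, i ≠ j → p i * p j = 0) ∧
      (∀ i x, p i x ∈ A i) ∧ (∀ i, ∀ x ∈ A i, p i x = x) := by
  classical
  letI := h.chooseDecomposition
  let p : ι → Module.End R M := fun i =>
    (A i).subtype ∘ₗ DirectSum.component R ι (fun i => A i) i ∘ₗ (DirectSum.decomposeLinearEquiv A).toLinearMap
  have hp : ∀ i x, p i x = (DirectSum.decompose A x i : M) := fun i x => rfl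
  have hmem : ∀ i x, p i x ∈ A i := fun i x => by rw [hp]; exact (DirectSum.decompose A x i).2
  have hid : ∀ i, ∀ x ∈ A i, p i x = x := fun i x hx => by rw [hp]; exact DirectSum.decompose_of_mem_same A hx
  refine ⟨p, ?_, fun i => ?_, fun i j hij => ?_, hmem, hid⟩
  · ext x
    rw [LinearMap.sum_apply, Module.End.one_apply]
    simp only [hp]
    conv_rhs => rw [← DirectSum.sum_support_decompose A x]
    exact (Finset.sum_subset (Finset.subset_univ _) fun i _ hi => by
      rw [DFinsupp.notMem_support_iff.1 hi, ZeroMemClass.coe_zero]).symm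
  · ext x
    rw [Module.End.mul_apply, hid i _ (hmem i x)]
  · ext x
    rw [Module.End.mul_apply, LinearMap.zero_apply, hp i, DirectSum.decompose_of_mem_ne A (hmem j x) hij.symm]

/-! ## §2 Isotypic projectors of a semisimple Noetherian module -/

/-- **Isotypic projectors.**  A semisimple Noetherian `R`-module is the internal direct sum of its finitely many isotypic components (Mathlib `sSupIndep_isotypicComponents`,
`sSup_isotypicComponents`), so §1 gives `R`-linear projectors `p_c`, indexed by the components `c` (collected in a `Finset`), complete, idempotent, orthogonal, with
`p_c(M) ⊆ c` and `p_c = id` on `c`. [cite: Serre1977, §2.6 Thm. 8] -/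
theorem exists_idempotents_isotypicComponents (R M : Type*) [Ring R] [AddCommGroup M] [Module R M] [IsSemisimpleModule R M] [IsNoetherian R M] :
    ∃ (s : Finset (Submodule R M)) (p : Submodule R M → Module.End R M), (↑s = isotypicComponents R M) ∧ (∑ c ∈ s, p c = 1) ∧
      (∀ c ∈ s, p c * p c = p c) ∧ (∀ c ∈ s, ∀ c' ∈ s, c ≠ c' → p c * p c' = 0) ∧ (∀ c ∈ s, ∀ x, p c x ∈ c) ∧ (∀ c ∈ s, ∀ x ∈ c, p c x = x) := by
  classical
  haveI : Fintype (isotypicComponents R M) := Fintype.ofFinite _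
  let A : isotypicComponents R M → Submodule R M := fun c => c
  have hind : iSupIndep A := (sSupIndep_iff _).1 (sSupIndep_isotypicComponents R M)
  have htop : iSup A = ⊤ := by rw [← sSup_eq_iSup', sSup_isotypicComponents]
  obtain ⟨p, hsum, hidem, horth, hmem, hid⟩ :=
    exists_idempotents_of_isInternal A (DirectSum.isInternal_submodule_of_iSupIndep_of_iSup_eq_top hind htop)
  have hfin : (isotypicComponents R M).Finite := Set.toFinite _
  let P : Submodule R M → Module.End R M := fun c => if h : c ∈ isotypicComponents R M then p ⟨c, h⟩ else 0
  have hP : ∀ {c} (h : c ∈ isotypicComponents R M), P c = p ⟨c, h⟩ := fun h => dif_pos h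
  have hmemf : ∀ {c}, c ∈ hfin.toFinset ↔ c ∈ isotypicComponents R M := fun {c} => hfin.mem_toFinset
  refine ⟨hfin.toFinset, P, hfin.coe_toFinset, ?_, fun c hc => ?_, fun c hc c' hc' hcc' => ?_, fun c hc x => ?_, fun c hc x hx => ?_⟩
  · rw [Finset.sum_subtype hfin.toFinset (fun c => hmemf) P, ← hsum]
    exact Finset.sum_congr rfl fun c _ => by rw [hP c.2]
  · rw [hP (hmemf.1 hc)]
    exact hidem _
  · rw [hP (hmemf.1 hc), hP (hmemf.1 hc')]
    exact horth _ _ fun h => hcc' (congrArg Subtype.val h)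
  · rw [hP (hmemf.1 hc)]
    exact hmem ⟨c, hmemf.1 hc⟩ x
  · rw [hP (hmemf.1 hc)]
    exact hid _ x hx

/-! ## §3 Isotypic (`Q`-type) projectors of a finite-dimensional representation of a finite group -/

/-- **THE `Q`-TYPE PROJECTORS OF A FINITE GROUP REPRESENTATION** (Harish-Chandra's `P_d`).  `Q` finite, `k` a field of characteristic zero, `τ` a representation of `Q` on a
finite-dimensional `W`.  By Maschke `W` is semisimple over `k[Q]`; its finitely many isotypic components `c` (one per `Q`-type `d` occurring in `W`) carry a complete orthogonal
family of `k`-linear projectors `p_c ∈ End_k W` COMMUTING WITH EVERY `τ q` (transport of §2 along Mathlib's `asModuleEquiv`), with `p_c(W) = c` and `p_c = id` on `c`.  Feeding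
★ L2 `smoothTrace_eq_sum_integral_trace_idempotent` with this family at `W = V^{K′}`, `Q = K ∕ K′`, gives Harish-Chandra's `tr π(f) = Σ_d ∫ f Θ_d`, `Θ_d(g) = tr(P_d e_{K′} π(g) e_{K′} P_d)`.
[cite: HarishChandra1999, Lemma 14.8 and §15] [cite: Serre1977, §2.6 Thm. 8] -/
theorem exists_isotypic_idempotents_representation {k Q W : Type*} [Field k] [CharZero k] [Group Q] [Finite Q] [AddCommGroup W] [Module k W]
    [FiniteDimensional k W] (τ : Representation k Q W) :
    ∃ (s : Finset (Submodule (MonoidAlgebra k Q) τ.asModule)) (p : Submodule (MonoidAlgebra k Q) τ.asModule → Module.End k W),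
      (↑s = isotypicComponents (MonoidAlgebra k Q) τ.asModule) ∧ (∑ c ∈ s, p c = 1) ∧ (∀ c ∈ s, p c * p c = p c) ∧
      (∀ c ∈ s, ∀ c' ∈ s, c ≠ c' → p c * p c' = 0) ∧ (∀ c ∈ s, ∀ q : Q, p c * τ q = τ q * p c) ∧
      (∀ c ∈ s, ∀ x : W, τ.asModuleEquiv.symm (p c x) ∈ c) ∧ (∀ c ∈ s, ∀ x : W, τ.asModuleEquiv.symm x ∈ c → p c x = x) := by
  classical
  haveI : NeZero (Nat.card Q : k) := ⟨Nat.cast_ne_zero.2 Nat.card_pos.ne'⟩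
  haveI : Module.Finite k τ.asModule := ‹Module.Finite k W›
  haveI : IsNoetherian (MonoidAlgebra k Q) τ.asModule := isNoetherian_of_tower k (inferInstance : IsNoetherian k τ.asModule)
  obtain ⟨s, P, hs, hsum, hidem, horth, hmem, hid⟩ := exists_idempotents_isotypicComponents (MonoidAlgebra k Q) τ.asModule
  let e : τ.asModule ≃ₗ[k] W := τ.asModuleEquiv
  let p : Submodule (MonoidAlgebra k Q) τ.asModule → Module.End k W := fun c =>
    e.toLinearMap ∘ₗ (P c).restrictScalars k ∘ₗ e.symm.toLinearMap
  have hp : ∀ c x, p c x = e (P c (e.symm x)) := fun c x => rfl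
  refine ⟨s, p, hs, ?_, fun c hc => ?_, fun c hc c' hc' hcc' => ?_, fun c hc q => ?_, fun c hc x => ?_, fun c hc x hx => ?_⟩
  · ext x
    rw [LinearMap.sum_apply, Module.End.one_apply]
    simp only [hp]
    rw [← map_sum, ← LinearMap.sum_apply, hsum, Module.End.one_apply, LinearEquiv.apply_symm_apply]
  · ext x
    rw [Module.End.mul_apply, hp, hp, LinearEquiv.symm_apply_apply, ← Module.End.mul_apply, hidem c hc]
  · ext x
    rw [Module.End.mul_apply, hp, hp, LinearEquiv.symm_apply_apply, ← Module.End.mul_apply, horth c hc c' hc' hcc', LinearMap.zero_apply, map_zero,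
      LinearMap.zero_apply]
  · ext x
    rw [Module.End.mul_apply, Module.End.mul_apply, hp, hp, Representation.asModuleEquiv_symm_map_rho, map_smul, Representation.asModuleEquiv_map_smul,
      Representation.asAlgebraHom_of]
  · rw [hp, LinearEquiv.symm_apply_apply]
    exact hmem c hc _
  · rw [hp, hid c hc _ hx, LinearEquiv.apply_symm_apply]

end Summit.HodgeConjecture.HodgeConjecture.Cruxes.H413.K2E3IsotypicIdempotents

end
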